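import Summits.QuantumFields.YangMills.Theorems.BalabanUVNodesN15KingModelRungUnit
import Literature.MathematicalPhysics.QuantumFieldTheory.King1986.SlicePropagatorStatements

/-!
# BalabanUVNodes ∕ N15 — THE KING-MODEL RUNG, CURVED EDITION (PART A): NE2's SITE-LAYER OBJECT FOR THE H-KERNEL **WITH THE
# BACKGROUND `A`** on an abstract two-spacing datum, and its η-rate BY NAME FROM KING'S PRINTED PROPOSITION 3.8 (3.71)
# (`King1986.SlicePropagator.Prop38Printed`) — objects, unit-block structure, carrier, pairing, sup entries, step bounds
# (Track A, DAG node N15 = NE2; FAN-OUT v1.1 §N15 s3 «KING-MODEL RUNG … + the one-line statement of what the curved case adds»)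

HONEST FRAMING.  Count-neutral kernel bookkeeping (cell `pub-ymgap`, seat `pub-ymgap-dag-n15-e` g3, strategy s3 «alternative currency:
located caveat admitted as hypothesis»; `--supports stmt-QuantumFields-19792 --as helper` = K3′ `SpineGivenEndpointR12`, lineage K3 19676).  The input is C. King's U(1)-Higgs
model in `d = 2, 3` WITH a regular background `A` ([King1986] Prop. 3.8 p. 664 — printed AND proved in print, §4 there), typed by the cell's
literature seat as the HYPOTHESIS SCHEMA `SlicePropagator.Prop38Printed T C δ₀ γ` over ABSTRACT two-spacing data `T : TwoSpacing d`
(`King1986/SlicePropagatorStatements.lean`; King's operators with `A ≠ 0` are not constructed there or here).  This file CONSUMES that schema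
by name; it proves nothing of King's and nothing of Bałaban's: NOT the covariant minimiser `H_k(U)` of [Balaban1985BackgroundPropagators]
Sect. D, for which NE2⁺ is NOT PRINTED and not proved; NOT a node discharge; nothing continuum ∕ ℝ⁴ ∕ OS ∕ mass-gap ∕ Clay.  0 `sorry`,
standard axioms; the `def`s are plumbing (a unit-block structure on the abstract data, two inert-argument geometries, a pairing, an index,
two sup entries).

THE POINT.  Parts 3–4 of this rung (`…N15KingModelMinimizer`, `…N15KingModelMinimizerNode`, seat g2) read node N15's SITE layer
`T4EtaRate.NE2PlusSite` on the `A = 0` analogue of [B9]'s H-kernel (3.133) — King's block-spin minimiser `ℋ_K = a_KG^η_KQ^*_K` on the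
torus — through the SUP-OVER-THE-BLOCK η-difference entry `sup_{x′ ∈ B(y)} |ℋ_{K+1}(x′, b) − ℋ_K(x, b)|`, UNCONDITIONALLY (the tree proves
(3.71) lines 1–2 at `A = 0`), and could only SAY what the curved case adds.  King's curved statement is now in the tree as a named
predicate — Proposition 3.8 p. 664, verbatim: *"When x′ ∈ T_{η′}, we denote by x that point in T_η for which x′ ∈ B^n(x). **Proposition
3.8.** For x′, y′ ∈ T_{η′}, 0 < α < 1, and γ sufficiently small, |a_{k+n}G^{η′}_{k+n}Q^*_{k+n}(x′, z) − a_kG^η_kQ^*_k(x, z)|,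
|a_{k+n}∂^{η′}_μG^{η′}_{k+n}Q^*_{k+n}(x′, z) − a_k∂^η_μG^η_kQ^*_k(x, z)|, … ≦ CL^{−γk} exp[−δ₀{|x − z|, dist({x, y}, z)}]. (3.71)"* — so the
curved rung becomes a theorem about the two typed currencies.  THIS PART types the objects for EVERY two-spacing datum `T` (its background
`A`, volume and Dirichlet data are parameters of the abstract data) and reads lines 1–2 over whole unit blocks:
* §1 `UnitBlocking T D₀` — the unit-block structure King's sentence uses (the unit point `B(x)` labelling the block of `x`, the finite set of
  fine points `x′` over a unit block, `|dist(B(x), z) − dist(x, z)| ≤ D₀`); `curvedGeo` ∕ `curvedGeoHi` — `T`'s unit lattice `T^{(k)}` read as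
  the [B9] site carrier of the coarse ∕ fine run (every `len = L^kη = 1`; King's rate factor `(η∕L^jη)^γ = L^{−γk}`, `rateFactor_curvedGeo`,
  via `ContinuumLimit.eps_rpow`); `curvedPairing` (`n` extra scales); the index `CurvedIndex` (datum + blocking + cube size `M ≥ 1` +
  `L > 1`) and `curvedInstance`; the SUP ENTRIES `hEntry(y, z) = sup_{x′ over B(y)} |a_{k+n}G^{η′}Q^*(x′, z) − a_kG^ηQ^*(x, z)|` and
  `dhEntry` (with `Σ_μ`), and the site kernels `curvedHSite` ∕ `curvedDHSite`;
* §2 THE STEP BOUNDS FROM PRINT: a (3.71)-line-1 bound at every fine point ⇒ `hEntry ≤ C·e^{δ₀D₀}·e^{−δ₀|y − z|}·L^{−γk}`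
  (`hEntry_le_of_line1`), hence from `Prop38Printed T C δ₀ γ` BY NAME (**`hEntry_le_of_prop38Printed`**); the derivative line likewise
  (`dhEntry_le_of_line2`, **`dhEntry_le_of_prop38Printed`**, factor `d`).
PART B (`…N15KingModelCurvedHNode`) reads the layer off §2: the dictionary `EtaRateIneqSite ⟺ printed shape` on this carrier, the converse
«typed site inequality ⇒ (3.71) line 1's shape», `NE2PlusSite` on Prop-3.8 families, the readout, the one-point member.
WHAT BAŁABAN'S CASE STILL ADDS, now one level up (the abelian curved statement being consumed): (a) the NON-ABELIAN covariant `H_k(U)` of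
[B9] Sect. D; (b) the multiscale carrier `𝔅 = ⋃_j Λ_j` with (3.133)'s `(L^jη)^{−p}(L^{j′}η)^{−d}` prefactors (here one scale: unit sites);
(c) the LIVE WINDOW `∀ U, Reg335 c35 α₀ U → …` as a quantifier INSIDE one instance with constants uniform over it — here the background is a
parameter of the datum, the background sort is one-point ((3.35) reads `True`), and uniformity in `A` is uniformity over an index family;
(d) an η-DIFFERENCE statement at all: [B9] prints analyticity in `U` (Thm 3.4) and η-uniformity, never an η-difference (`T4EtaRate` header).
HONEST SCOPE.  (i) Lines 3–4 of (3.71) (the Hölder quotients, [B9]'s (3.43)–(3.45), untyped in `T4EtaRate`) are carried inside the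
hypothesis `Prop38Printed` and NOT consumed; NB the schema quantifies them `∀ α ∈ (0, 1)` at the fixed outer `(C, γ)`, while King's §4 proof
realises «γ sufficiently small» with `γ = γ(α)` (tree, `A = 0`: `King1986.Torus.king_prop38_holder_torus_blocks` needs `α + γ ≤ 1`) —
immaterial for lines 1–2.  (ii) Observation sites are unit points, the entry reads EVERY fine point over the unit block (no base-point
collapse); sources are unit points `z ∈ T^{(k)}` as printed.  (iii) The unit-block structure is NOT part of the literature schema: it is the
data King's sentence «that point x in T_η for which x′ ∈ B^n(x)» and (3.64)'s `dist(B^j(x), b)` presuppose, posited here abstractly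
(`UnitBlocking`), with the one metric fact used (`|dist(B(x), z) − dist(x, z)| ≤ D₀`, the block diameter).  (iv) Prop. 3.9 (3.73)–(3.75)
(the slice propagators, [B9]'s OPERATOR class) is not read here: its operator-layer reading needs the slices' action on test functions,
which the abstract schema does not carry (the `A = 0` top piece is part 1's `ne2PlusOperator_topPiece`).
Locators: [King1986] C. King, CMP **102** (1986) 649–677: (2.13)–(2.17) p. 653, p. 656 (the unit lattice `T^{(k)}`), (3.62)–(3.64) p. 663,
p. 664 (pairing sentence) + Prop. 3.8 (3.71) p. 664, Prop. 3.9 p. 665, §4 p. 674; [B9] = [Balaban1985BackgroundPropagators] CMP **99** (1985):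
(3.35) p. 396, Thm 3.2 (3.48) p. 398, Thm 3.4 p. 400, (3.132)–(3.133) p. 422, Thm 3.14 pp. 426–427 (typing template).
-/

noncomputable section

namespace Summit.QuantumFields.YangMills.BalabanUVNodes.N15KingModelRung.Curved

open Real Finset
open Literature.MathematicalPhysics.QuantumFieldTheory.Balaban1983to89
open Literature.MathematicalPhysics.QuantumFieldTheory.Balaban1983to89.T4EtaRate (PairedInstance EtaPairing EtaRateIneqSite NE2PlusSite
  rateFactor rateFactor_unit)
open Literature.MathematicalPhysics.QuantumFieldTheory.Balaban1983to89.T4EtaRateSiteOfRatePair (NE2ZeroSite ne2ZeroSite_of_ne2PlusSite)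
open Literature.MathematicalPhysics.QuantumFieldTheory.Balaban1983to89.T4EtaRateDefectSite (pt9Bg)
open Literature.MathematicalPhysics.QuantumFieldTheory.King1986.ContinuumLimit (eps eps_pos eps_rpow)
open Literature.MathematicalPhysics.QuantumFieldTheory.King1986.SlicePropagator (SliceKernels TwoSpacing Prop38Printed)

variable {d : ℕ}

/-! ## §1 The objects: King's unit-block structure on a two-spacing datum, the unit-lattice carrier, the pairing, the sup entries -/

section Object

/-- THE UNIT-BLOCK STRUCTURE King's two-spacing sentence presupposes, posited on an abstract datum `T` (HONEST SCOPE (iii)):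
`blk x` = the unit-lattice point `z ∈ T^{(k)}` labelling the unit block of the coarse point `x ∈ T_η` (p. 656: the unit lattice
`T^{(k)} ⊂ T_η`; p. 664: *"we denote by x that point in T_η for which x′ ∈ B^n(x)"*), `fibre y` = the finite set of fine points
`x′ ∈ T_{η′}` whose coarse point `x` lies in the unit block of `y`, and the one metric fact used below — replacing a point by its block
label moves a distance to a unit point by at most the block diameter `D₀`. [cite: King1986, p.656 (unit lattice), (3.64) p.663 (block distance), p.664 (pairing sentence)] -/
structure UnitBlocking (T : TwoSpacing d) (D₀ : ℝ) where
  /-- the unit point labelling the unit block of a coarse point -/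
  blk : T.lo.S → T.lo.S
  /-- block labels are unit-lattice points -/
  isUnit_blk : ∀ x, T.IsUnit (blk x)
  /-- a unit point labels its own block -/
  blk_of_isUnit : ∀ z, T.IsUnit z → blk z = z
  /-- the fine points over the unit block labelled `y` -/
  fibre : T.lo.S → Finset T.hi.S
  /-- membership: `x′` is over the block of `y` iff the block label of its coarse point is `y` -/
  mem_fibre : ∀ (y : T.lo.S) (x' : T.hi.S), x' ∈ fibre y ↔ blk (T.pt x') = y
  /-- every unit block carries a fine point -/
  fibre_nonempty : ∀ y, T.IsUnit y → (fibre y).Nonempty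
  /-- `|dist(B(x), z) − dist(x, z)| ≤ D₀` for unit `z` -/
  abs_dist_blk_sub_le : ∀ (x z : T.lo.S), T.IsUnit z → |T.lo.dist (blk x) z - T.lo.dist x z| ≤ D₀

/-- THE COARSE RUN'S UNIT LATTICE AS A [B9] SITE CARRIER: sites = the unit points `z ∈ T^{(k)}` of `T_η` (all of scale index `k`,
physical size `L^kη = 1`), distance `|y − z|` of the datum, `η = L^{−k}` (`SliceKernels.η`), block factor `L`, cube size `M` (an index
parameter, inert here — carried so that the guard `M₅ ≤ M` of the packaged shapes is co-final, as in `T4EtaRateSiteOfRatePair` v1.2);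
argument ∕ cut-off sorts inert (as `windowGeo`). [cite: Balaban1985BackgroundPropagators, (3.41) p.397 (site scale convention); King1986, p.656 (unit lattice)] -/
@[reducible] def curvedGeo (T : TwoSpacing d) (M : ℝ) : B9.Geometry where
  Site := {z : T.lo.S // T.IsUnit z}
  scale := fun _ => T.lo.k
  dist := fun y z => T.lo.dist y.1 z.1
  k := T.lo.k
  eta := T.lo.η
  L := T.lo.L
  M := M
  Loc := Unit
  suppIn := fun _ _ => True
  suppInT := fun _ _ => True
  supNorm := fun _ => 0
  l2Norm := fun _ => 0
  wNorm := fun _ _ => 0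
  holder := fun _ _ => 0
  Cut := Unit
  cutIn := fun _ _ => True
  cutInT := fun _ _ => True
  cutH := fun _ _ => 0
  cutSup := fun _ => 0
  suppInT_of_suppIn := fun _ _ h => h
  cutInT_of_cutIn := fun _ _ h => h

/-- THE FINE RUN'S GEOMETRY ON THE SAME UNIT LATTICE (p. 656: both runs live over the same unit lattice `T^{(k)}`): scale index `k + n`,
`η′ = L^{−(k+n)}`, same sites and distance. [cite: King1986, p.656 (unit lattice), p.664 (two spacings)] -/
@[reducible] def curvedGeoHi (T : TwoSpacing d) (M : ℝ) : B9.Geometry where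
  Site := {z : T.lo.S // T.IsUnit z}
  scale := fun _ => T.hi.k
  dist := fun y z => T.lo.dist y.1 z.1
  k := T.hi.k
  eta := T.hi.η
  L := T.hi.L
  M := M
  Loc := Unit
  suppIn := fun _ _ => True
  suppInT := fun _ _ => True
  supNorm := fun _ => 0
  l2Norm := fun _ => 0
  wNorm := fun _ _ => 0
  holder := fun _ _ => 0
  Cut := Unit
  cutIn := fun _ _ => True
  cutInT := fun _ _ => True
  cutH := fun _ _ => 0
  cutSup := fun _ => 0
  suppInT_of_suppIn := fun _ _ h => h
  cutInT_of_cutIn := fun _ _ h => h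

section Carrier

variable (T : TwoSpacing d) (M : ℝ)

/-- The carrier's distance is the datum's `|y − z|`. [folklore] -/
@[simp] theorem curvedGeo_dist (y z : (curvedGeo T M).Site) : (curvedGeo T M).dist y z = T.lo.dist y.1 z.1 := rfl

/-- Every site of the carrier has physical size `L^kη = 1` (`L ≠ 0`). [folklore] -/
theorem curvedGeo_len (hL : 0 < T.lo.L) (y : (curvedGeo T M).Site) : (curvedGeo T M).len y = 1 := by
  show (T.lo.L : ℝ) ^ T.lo.k * ((T.lo.L : ℝ) ^ T.lo.k)⁻¹ = 1
  have hL' : (T.lo.L : ℝ) ≠ 0 := by exact_mod_cast hL.ne'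
  exact mul_inv_cancel₀ (pow_ne_zero _ hL')

/-- KING'S RATE FACTOR ON THE UNIT LATTICE IS THE PRINTED `L^{−γk}`: `(η∕L^jη)^γ = η^γ = L^{−γk}` (`T4EtaRate.rateFactor_unit` +
`ContinuumLimit.eps_rpow`). [cite: King1986, Prop. 3.8 (3.71) p.664 (the factor `L^{−γk}`)] -/
theorem rateFactor_curvedGeo (hL : 0 < T.lo.L) (γ : ℝ) (y : (curvedGeo T M).Site) :
    rateFactor (curvedGeo T M) γ y = (T.lo.L : ℝ) ^ (-(γ * T.lo.k)) := by
  rw [rateFactor_unit γ (curvedGeo_len T M hL y)]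
  exact eps_rpow hL T.lo.k γ

end Carrier

/-- THE η-PAIRING OF THE TWO RUNS on the unit lattice: `n` extra scales (`η′L^n = η`), unit sites ∕ arguments ∕ backgrounds transported
identically (King's pairing acts on the fine points inside the sup entries below, not on the unit sites). [cite: King1986, p.664 (convention before Prop. 3.8)] -/
def curvedPairing (T : TwoSpacing d) (hL : 0 < T.lo.L) (M : ℝ) : EtaPairing (curvedGeo T M) (curvedGeoHi T M) pt9Bg pt9Bg where
  n := T.n
  k_eq := T.k_hi
  L_eq := by
    show ((T.hi.L : ℕ) : ℝ) = ((T.lo.L : ℕ) : ℝ)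
    rw [T.L_hi]
  M_eq := rfl
  eta_eq := by
    show eps T.hi.L T.hi.k * ((T.hi.L : ℕ) : ℝ) ^ T.n = eps T.lo.L T.lo.k
    rw [T.L_hi, T.k_hi]
    have hL' : (T.lo.L : ℝ) ≠ 0 := by exact_mod_cast hL.ne'
    simp only [eps]
    rw [pow_add, mul_inv, mul_assoc, inv_mul_cancel₀ (pow_ne_zero _ hL'), mul_one]
  ι := fun y => y
  scale_ι := fun _ => T.k_hi
  dist_ι := fun _ _ => rfl
  τ := fun lam => lam
  suppIn_τ := fun _ _ h => h
  supNorm_τ := fun _ => le_rfl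
  avg := fun U => U
  avg_one := rfl

/-- THE INDEX OF THE CURVED FAMILY: a two-spacing datum (its background `A` a parameter of the data), its unit-block structure with
block slack `D₀`, the cube size `M ≥ 1` (co-final guard, `T4EtaRateSiteOfRatePair` v1.2), and `L > 1`. [folklore] -/
structure CurvedIndex (d : ℕ) (D₀ : ℝ) where
  /-- the two-spacing datum -/
  T : TwoSpacing d
  /-- its unit-block structure -/
  β : UnitBlocking T D₀
  /-- [B9]'s cube-size parameter -/
  M : ℝ
  /-- `M ≥ 1` -/
  one_le_M : 1 ≤ M
  /-- `L > 1` -/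
  one_lt_L : 1 < T.lo.L

/-- `L > 0` on an index. [folklore] -/
theorem CurvedIndex.L_pos {D₀ : ℝ} (i : CurvedIndex d D₀) : 0 < i.T.lo.L := lt_trans zero_lt_one i.one_lt_L

/-- THE PAIRED INSTANCE of an index: the two runs' unit-lattice geometries over the one-point background sort (the background is a
parameter of the datum; HONEST SCOPE (c) of the header). [folklore] -/
def curvedInstance (D₀ : ℝ) (i : CurvedIndex d D₀) : PairedInstance where
  gc := curvedGeo i.T i.M
  gf := curvedGeoHi i.T i.M
  Bc := pt9Bg
  Bf := pt9Bg
  pair := curvedPairing i.T i.L_pos i.M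

variable {T : TwoSpacing d} {D₀ : ℝ}

/-- **THE H-KERNEL'S η-DIFFERENCE SUP ENTRY WITH THE BACKGROUND** at observation unit point `y` and source unit point `z`:
`sup_{x′ over B(y)} |a_{k+n}G^{η′}_{k+n}Q^*_{k+n}(x′, z) − a_kG^η_kQ^*_k(x, z)|`, `x` under `x′` — every fine point over the unit block is read
(the `p = 0` sup entry of the H-kernel, [B9] (3.133), for the difference family). [cite: Balaban1985BackgroundPropagators, (3.133) p.422 (sup-entry shape); King1986, Prop. 3.8 (3.71) p.664 (first line, object)] -/
def hEntry (β : UnitBlocking T D₀) (y z : {z : T.lo.S // T.IsUnit z}) : ℝ :=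
  (β.fibre y.1).sup' (β.fibre_nonempty y.1 y.2) fun x' => |T.K' x' z.1 - T.K (T.pt x') z.1|

/-- **THE DERIVATIVE SUP ENTRY**: `sup_{x′ over B(y)} Σ_μ |a_{k+n}∂^{η′}_μG^{η′}_{k+n}Q^*_{k+n}(x′, z) − a_k∂^η_μG^η_kQ^*_k(x, z)|` (the `p = 1`
entry). [cite: Balaban1985BackgroundPropagators, (3.133) p.422 (sup-entry shape); King1986, Prop. 3.8 (3.71) p.664 (second line, object)] -/
def dhEntry (β : UnitBlocking T D₀) (y z : {z : T.lo.S // T.IsUnit z}) : ℝ :=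
  (β.fibre y.1).sup' (β.fibre_nonempty y.1 y.2) fun x' => ∑ μ : Fin d, |T.dK' μ x' z.1 - T.dK μ (T.pt x') z.1|

/-- The pointwise difference at a fine point over the block is dominated by the sup entry. [folklore] -/
theorem abs_sub_le_hEntry (β : UnitBlocking T D₀) (y z : {z : T.lo.S // T.IsUnit z}) {x' : T.hi.S} (hx' : x' ∈ β.fibre y.1) :
    |T.K' x' z.1 - T.K (T.pt x') z.1| ≤ hEntry β y z :=
  Finset.le_sup' (fun x' => |T.K' x' z.1 - T.K (T.pt x') z.1|) hx'

/-- The pointwise derivative difference (summed over directions) is dominated by the derivative sup entry. [folklore] -/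
theorem sum_abs_sub_le_dhEntry (β : UnitBlocking T D₀) (y z : {z : T.lo.S // T.IsUnit z}) {x' : T.hi.S} (hx' : x' ∈ β.fibre y.1) :
    ∑ μ : Fin d, |T.dK' μ x' z.1 - T.dK μ (T.pt x') z.1| ≤ dhEntry β y z :=
  Finset.le_sup' (fun x' => ∑ μ : Fin d, |T.dK' μ x' z.1 - T.dK μ (T.pt x') z.1|) hx'

/-- The sup entry is nonnegative. [folklore] -/
theorem hEntry_nonneg (β : UnitBlocking T D₀) (y z : {z : T.lo.S // T.IsUnit z}) : 0 ≤ hEntry β y z := by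
  obtain ⟨x', hx'⟩ := β.fibre_nonempty y.1 y.2
  exact (abs_nonneg _).trans (abs_sub_le_hEntry β y z hx')

/-- The derivative sup entry is nonnegative. [folklore] -/
theorem dhEntry_nonneg (β : UnitBlocking T D₀) (y z : {z : T.lo.S // T.IsUnit z}) : 0 ≤ dhEntry β y z := by
  obtain ⟨x', hx'⟩ := β.fibre_nonempty y.1 y.2
  exact (Finset.sum_nonneg fun μ _ => abs_nonneg _).trans (sum_abs_sub_le_dhEntry β y z hx')

/-- THE H-KERNEL's η-difference WITH THE BACKGROUND as a SITE kernel on the curved family (observation site first, source site second).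
[cite: Balaban1985BackgroundPropagators, (3.133) p.422 (shape); King1986, Prop. 3.8 p.664 (object)] -/
def curvedHSite (D₀ : ℝ) : ∀ i : CurvedIndex d D₀, B9.SiteKernel (curvedInstance D₀ i).gc (curvedInstance D₀ i).Bf :=
  fun i => ⟨fun _ y z => hEntry i.β y z⟩

/-- Its derivative companion as a SITE kernel. [cite: Balaban1985BackgroundPropagators, (3.133) p.422 (shape); King1986, Prop. 3.8 p.664 (second line, object)] -/
def curvedDHSite (D₀ : ℝ) : ∀ i : CurvedIndex d D₀, B9.SiteKernel (curvedInstance D₀ i).gc (curvedInstance D₀ i).Bf :=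
  fun i => ⟨fun _ y z => dhEntry i.β y z⟩

end Object

/-! ## §2 The step bounds FROM PRINT: Proposition 3.8 (3.71), lines 1–2, by name ⇒ the sup entries' rate -/

section Step

variable {T : TwoSpacing d} {D₀ : ℝ}

/-- Replacing a coarse point by its block label costs at most `e^{δ₀D₀}` in the decay factor (`δ₀ ≥ 0`). [folklore] -/
theorem exp_dist_le_of_blk (β : UnitBlocking T D₀) {δ₀ : ℝ} (hδ₀ : 0 ≤ δ₀) (x z : T.lo.S) (hz : T.IsUnit z) :
    Real.exp (-(δ₀ * T.lo.dist x z)) ≤ Real.exp (δ₀ * D₀) * Real.exp (-(δ₀ * T.lo.dist (β.blk x) z)) := by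
  rw [← Real.exp_add]
  refine Real.exp_le_exp.mpr ?_
  have h := (abs_le.mp (β.abs_dist_blk_sub_le x z hz)).2
  nlinarith

/-- … and conversely, replacing the block label by the point costs at most `e^{δ₀D₀}`. [folklore] -/
theorem exp_dist_blk_le (β : UnitBlocking T D₀) {δ₀ : ℝ} (hδ₀ : 0 ≤ δ₀) (x z : T.lo.S) (hz : T.IsUnit z) :
    Real.exp (-(δ₀ * T.lo.dist (β.blk x) z)) ≤ Real.exp (δ₀ * D₀) * Real.exp (-(δ₀ * T.lo.dist x z)) := by
  rw [← Real.exp_add]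
  refine Real.exp_le_exp.mpr ?_
  have h := (abs_le.mp (β.abs_dist_blk_sub_le x z hz)).1
  nlinarith

/-- **A (3.71)-LINE-1 BOUND AT EVERY FINE POINT, READ OVER THE WHOLE UNIT BLOCK**: if
`|a_{k+n}G^{η′}Q^*(x′, z) − a_kG^ηQ^*(x, z)| ≤ C·L^{−γk}·e^{−δ₀|x − z|}` for all fine `x′` (`x` under it) and unit `z` (`C, δ₀ ≥ 0`), then for
all unit points `y, z` the sup entry obeys `≤ C·e^{δ₀D₀}·e^{−δ₀|y − z|}·L^{−γk}` — the pointwise bound, its `e^{−δ₀|x − z|}` traded for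
`e^{−δ₀|B(x) − z|}` at the cost `e^{δ₀D₀}`. [cite: King1986, Prop. 3.8 (3.71) p.664 (first line, shape)] [folklore] -/
theorem hEntry_le_of_line1 (β : UnitBlocking T D₀) {C δ₀ γ : ℝ} (hC : 0 ≤ C) (hδ₀ : 0 ≤ δ₀)
    (h1 : ∀ (x' : T.hi.S) (z : T.lo.S), T.IsUnit z →
      |T.K' x' z - T.K (T.pt x') z| ≤ C * (T.lo.L : ℝ) ^ (-(γ * T.lo.k)) * Real.exp (-(δ₀ * T.lo.dist (T.pt x') z)))
    (y z : {z : T.lo.S // T.IsUnit z}) :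
    hEntry β y z ≤ C * Real.exp (δ₀ * D₀) * Real.exp (-(δ₀ * T.lo.dist y.1 z.1)) * (T.lo.L : ℝ) ^ (-(γ * T.lo.k)) := by
  refine Finset.sup'_le _ _ fun x' hx' => ?_
  have hblk : β.blk (T.pt x') = y.1 := (β.mem_fibre y.1 x').1 hx'
  have hexp := exp_dist_le_of_blk β hδ₀ (T.pt x') z.1 z.2
  rw [hblk] at hexp
  have hr : 0 ≤ C * (T.lo.L : ℝ) ^ (-(γ * T.lo.k)) := mul_nonneg hC (Real.rpow_nonneg (Nat.cast_nonneg _) _)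
  calc |T.K' x' z.1 - T.K (T.pt x') z.1|
      ≤ C * (T.lo.L : ℝ) ^ (-(γ * T.lo.k)) * Real.exp (-(δ₀ * T.lo.dist (T.pt x') z.1)) := h1 x' z.1 z.2
    _ ≤ C * (T.lo.L : ℝ) ^ (-(γ * T.lo.k)) * (Real.exp (δ₀ * D₀) * Real.exp (-(δ₀ * T.lo.dist y.1 z.1))) :=
        mul_le_mul_of_nonneg_left hexp hr
    _ = C * Real.exp (δ₀ * D₀) * Real.exp (-(δ₀ * T.lo.dist y.1 z.1)) * (T.lo.L : ℝ) ^ (-(γ * T.lo.k)) := by ring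

/-- **(3.71) LINE 1, BY NAME (`Prop38Printed`), READ OVER THE WHOLE UNIT BLOCK**: `Prop38Printed T C δ₀ γ` (`C, δ₀ ≥ 0`) gives, for all unit
points `y, z`, `sup_{x′ over B(y)} |a_{k+n}G^{η′}_{k+n}Q^*_{k+n}(x′, z) − a_kG^η_kQ^*_k(x, z)| ≤ C·e^{δ₀D₀}·e^{−δ₀|y − z|}·L^{−γk}`.
[cite: King1986, Prop. 3.8 (3.71) p.664 (first line)] -/
theorem hEntry_le_of_prop38Printed (β : UnitBlocking T D₀) {C δ₀ γ : ℝ} (hC : 0 ≤ C) (hδ₀ : 0 ≤ δ₀)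
    (h38 : Prop38Printed T C δ₀ γ) (y z : {z : T.lo.S // T.IsUnit z}) :
    hEntry β y z ≤ C * Real.exp (δ₀ * D₀) * Real.exp (-(δ₀ * T.lo.dist y.1 z.1)) * (T.lo.L : ℝ) ^ (-(γ * T.lo.k)) :=
  hEntry_le_of_line1 β hC hδ₀ (fun x' z hz => (h38.1 x' z hz).1) y z

/-- **A (3.71)-LINE-2 BOUND AT EVERY FINE POINT, READ OVER THE WHOLE UNIT BLOCK**: the derivative sup entry obeys
`≤ d·C·e^{δ₀D₀}·e^{−δ₀|y − z|}·L^{−γk}` (`d` directions). [cite: King1986, Prop. 3.8 (3.71) p.664 (second line, shape)] [folklore] -/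
theorem dhEntry_le_of_line2 (β : UnitBlocking T D₀) {C δ₀ γ : ℝ} (hC : 0 ≤ C) (hδ₀ : 0 ≤ δ₀)
    (h2 : ∀ (x' : T.hi.S) (z : T.lo.S), T.IsUnit z → ∀ μ : Fin d,
      |T.dK' μ x' z - T.dK μ (T.pt x') z| ≤ C * (T.lo.L : ℝ) ^ (-(γ * T.lo.k)) * Real.exp (-(δ₀ * T.lo.dist (T.pt x') z)))
    (y z : {z : T.lo.S // T.IsUnit z}) :
    dhEntry β y z ≤ d * C * Real.exp (δ₀ * D₀) * Real.exp (-(δ₀ * T.lo.dist y.1 z.1)) * (T.lo.L : ℝ) ^ (-(γ * T.lo.k)) := by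
  refine Finset.sup'_le _ _ fun x' hx' => ?_
  have hblk : β.blk (T.pt x') = y.1 := (β.mem_fibre y.1 x').1 hx'
  have hexp := exp_dist_le_of_blk β hδ₀ (T.pt x') z.1 z.2
  rw [hblk] at hexp
  have hr : 0 ≤ C * (T.lo.L : ℝ) ^ (-(γ * T.lo.k)) := mul_nonneg hC (Real.rpow_nonneg (Nat.cast_nonneg _) _)
  calc ∑ μ : Fin d, |T.dK' μ x' z.1 - T.dK μ (T.pt x') z.1|
      ≤ ∑ _μ : Fin d, C * (T.lo.L : ℝ) ^ (-(γ * T.lo.k)) * (Real.exp (δ₀ * D₀) * Real.exp (-(δ₀ * T.lo.dist y.1 z.1))) :=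
        Finset.sum_le_sum fun μ _ => (h2 x' z.1 z.2 μ).trans (mul_le_mul_of_nonneg_left hexp hr)
    _ = d * C * Real.exp (δ₀ * D₀) * Real.exp (-(δ₀ * T.lo.dist y.1 z.1)) * (T.lo.L : ℝ) ^ (-(γ * T.lo.k)) := by
        rw [Finset.sum_const, Finset.card_univ, Fintype.card_fin, nsmul_eq_mul]
        ring

/-- **(3.71) LINE 2, BY NAME (`Prop38Printed`), READ OVER THE WHOLE UNIT BLOCK**: the derivative sup entry obeys
`≤ d·C·e^{δ₀D₀}·e^{−δ₀|y − z|}·L^{−γk}`. [cite: King1986, Prop. 3.8 (3.71) p.664 (second line)] -/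
theorem dhEntry_le_of_prop38Printed (β : UnitBlocking T D₀) {C δ₀ γ : ℝ} (hC : 0 ≤ C) (hδ₀ : 0 ≤ δ₀)
    (h38 : Prop38Printed T C δ₀ γ) (y z : {z : T.lo.S // T.IsUnit z}) :
    dhEntry β y z ≤ d * C * Real.exp (δ₀ * D₀) * Real.exp (-(δ₀ * T.lo.dist y.1 z.1)) * (T.lo.L : ℝ) ^ (-(γ * T.lo.k)) :=
  dhEntry_le_of_line2 β hC hδ₀ (fun x' z hz => (h38.1 x' z hz).2) y z

end Step

end Summit.QuantumFields.YangMills.BalabanUVNodes.N15KingModelRung.Curved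

end
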